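import Summits.QuantumFields.YangMills.Theorems.BalabanUVNodesK1V9Defs

/-! DEF-1 g9 — BY-NAME CHECK for plan g86's R1W draft (`D86-K1V9/r1w/K1Skeleton13SepCoPHv10draft.lean` fa98b8468a6788c1): the three LINE-2′ (window-guarded) rung texts, copied
byte-for-byte from the draft, read over the TREE names of `K1V9Defs` (p628520: `RecordSV`, the V rungs) — and the doors V ⟹ VW ∕ LINE 1 ⟹ VW as one-liners.  Scratch; not filed. -/

noncomputable section

open scoped Matrix.Norms.L2Operator

namespace Summit.QuantumFields.YangMills.Cruxes.DEF1R1WDoorCheck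

open Literature.MathematicalPhysics.QuantumFieldTheory.Balaban1983to89
open Literature.MathematicalPhysics.QuantumFieldTheory.Balaban1983to89.T4Continuum
open Literature.MathematicalPhysics.QuantumFieldTheory.Balaban1983to89.DagBinding
open FlowStepRuns
open FlowStep (HBeta RGEqH prefixOf)
open Summit.QuantumFields.YangMills.Theorems.BalabanUVNodesK2NamedJetsRunRemAt (RunRemAt RunConstRemainder SurvCont)
open Summit.QuantumFields.YangMills.Theorems.K1V6Defs (RecordS Inhabited13 NodesAtSomeRecord13PWS RunRowsAtSomeRecord13PWS Window)
open Summit.QuantumFields.YangMills.Theorems.K1V7RDefs (RunRowsContAtSomeRecord13PWS)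
open Summit.QuantumFields.YangMills.Theorems.K1V9Defs

def NodesAtSomeRecord13PWSVW (F : T4Family) : Prop :=
  ∃ (θ : Node00.Stage13HParams F 2) (h : θ.Provisos₁₃SepCoPH F 2) (v : Node00.Revision₁₃ F 2 θ h) (w : WorldP), (θ.ZhUnity F 2 ∧ θ.SlotsNondegenerate₁₃ F 2) ∧ θ.Admissible F 2 ∧
    RecordSV F θ h v w ∧ (∀ P : B12.RunParams, (leavesP w P).smallCouplings → Nodes (leavesP w P)) ∧ Node00.PrintedUV3V 2 θ.L ∧
    ∃ lam : Node00.ResidW F 2, (∀ P : B12.RunParams, 1 ≤ P.K → lam.kSel P < P.K) ∧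
      ∀ P : B12.RunParams, lam.kSel P < P.K → (leavesP w P).smallCouplings → ((leavesP w P).rBasicStep ↔ B15Leaf (Node00.WOfRecord₁₃ F 2 θ.toStage13Params lam P))

def RunRowsAtSomeRecord13PWSVW (F : T4Family) : Prop :=
  ∃ (θ : Node00.Stage13HParams F 2) (h : θ.Provisos₁₃SepCoPH F 2) (v : Node00.Revision₁₃ F 2 θ h) (w : WorldP), (θ.ZhUnity F 2 ∧ θ.SlotsNondegenerate₁₃ F 2) ∧ θ.Admissible F 2 ∧
    RecordSV F θ h v w ∧ (∀ P : B12.RunParams, (leavesP w P).smallCouplings → Nodes (leavesP w P)) ∧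
    ∃ (b : ℕ → ℝ) (r γ₀ B M : ℝ), 0 < γ₀ ∧ RunConstRemainder (Node00.betaOfRecord₁₃ F 2 θ.toStage13Params) b r γ₀ ∧ (∀ k, b k ≤ B) ∧ B + r ≤ w.βup ∧
      ∀ (n : ℕ) (gs : ℕ → ℝ), RGEqH n (Node00.betaOfRecord₁₃ F 2 θ.toStage13Params) gs → Step.InInterval γ₀ n gs →
        ∀ k, k ≤ n → -M ≤ ∑ j ∈ Finset.Ico k n, Node00.betaOfRecord₁₃ F 2 θ.toStage13Params j (prefixOf gs j)

def RunRowsContAtSomeRecord13PWSVW (F : T4Family) : Prop :=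
  ∃ (θ : Node00.Stage13HParams F 2) (h : θ.Provisos₁₃SepCoPH F 2) (v : Node00.Revision₁₃ F 2 θ h) (w : WorldP), (θ.ZhUnity F 2 ∧ θ.SlotsNondegenerate₁₃ F 2) ∧ θ.Admissible F 2 ∧
    RecordSV F θ h v w ∧ (∀ P : B12.RunParams, (leavesP w P).smallCouplings → Nodes (leavesP w P)) ∧
    ∃ (b : ℕ → ℝ) (r γ₀ B M : ℝ), 0 < γ₀ ∧ RunConstRemainder (Node00.betaOfRecord₁₃ F 2 θ.toStage13Params) b r γ₀ ∧ (∀ k, b k ≤ B) ∧ B + r ≤ w.βup ∧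
      (∀ (n : ℕ) (gs : ℕ → ℝ), RGEqH n (Node00.betaOfRecord₁₃ F 2 θ.toStage13Params) gs → Step.InInterval γ₀ n gs →
        ∀ k, k ≤ n → -M ≤ ∑ j ∈ Finset.Ico k n, Node00.betaOfRecord₁₃ F 2 θ.toStage13Params j (prefixOf gs j)) ∧
      SurvCont (Node00.betaOfRecord₁₃ F 2 θ.toStage13Params) γ₀

theorem nodesAtSomeRecord13PWSVW_of_V {F : T4Family} (hN : NodesAtSomeRecord13PWSV F) : NodesAtSomeRecord13PWSVW F := by
  obtain ⟨θ, h, v, w, hU, hθ, hR, hnodes, h08, lam, hsel, hstep⟩ := hN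
  exact ⟨θ, h, v, w, hU, hθ, hR, fun P _ => hnodes P, h08, lam, hsel, fun P hk _ => hstep P hk⟩

theorem runRowsAtSomeRecord13PWSVW_of_V {F : T4Family} (hN : RunRowsAtSomeRecord13PWSV F) : RunRowsAtSomeRecord13PWSVW F := by
  obtain ⟨θ, h, v, w, hU, hθ, hR, hnodes, b, r, γ₀, B, M, hγ₀, hrem, hB, hmatch, hps⟩ := hN
  exact ⟨θ, h, v, w, hU, hθ, hR, fun P _ => hnodes P, b, r, γ₀, B, M, hγ₀, hrem, hB, hmatch, hps⟩

theorem runRowsContAtSomeRecord13PWSVW_of_V {F : T4Family} (hN : RunRowsContAtSomeRecord13PWSV F) : RunRowsContAtSomeRecord13PWSVW F := by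
  obtain ⟨θ, h, v, w, hU, hθ, hR, hnodes, b, r, γ₀, B, M, hγ₀, hrem, hB, hmatch, hps, hsc⟩ := hN
  exact ⟨θ, h, v, w, hU, hθ, hR, fun P _ => hnodes P, b, r, γ₀, B, M, hγ₀, hrem, hB, hmatch, hps, hsc⟩

theorem nodesAtSomeRecord13PWSVW_of_line1 {F : T4Family} (hN : NodesAtSomeRecord13PWS F) : NodesAtSomeRecord13PWSVW F :=
  nodesAtSomeRecord13PWSVW_of_V (nodesAtSomeRecord13PWSV_of_line1 hN)

theorem runRowsContAtSomeRecord13PWSVW_of_line1 {F : T4Family} (hN : RunRowsContAtSomeRecord13PWS F) : RunRowsContAtSomeRecord13PWSVW F :=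
  runRowsContAtSomeRecord13PWSVW_of_V (runRowsContAtSomeRecord13PWSV_of_line1 hN)

/-- the guarded rung still hands DEF-1's per-tuple rows `RunRowsCont13 F θ` (θ-level, guard-free) at its witness -/
theorem exists_runRowsCont13_of_runRowsContAtSomeRecord13PWSVW (F : T4Family) (h : RunRowsContAtSomeRecord13PWSVW F) :
    ∃ (θ : Node00.Stage13HParams F 2) (h : θ.Provisos₁₃SepCoPH F 2) (v : Node00.Revision₁₃ F 2 θ h) (w : WorldP),
      RecordSV F θ h v w ∧ Summit.QuantumFields.YangMills.Theorems.BalabanUVNodesK1R8RowsDefs.RunRowsCont13 F θ := by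
  obtain ⟨θ, hP, v, w, -, -, hR, -, b, r, γ₀, B, M, hγ₀, hrem, -, -, hps, hsc⟩ := h
  exact ⟨θ, hP, v, w, hR, Summit.QuantumFields.YangMills.Theorems.BalabanUVNodesK1R8RowsDefs.runRowsCont13_intro θ hγ₀ hrem hps hsc⟩

end Summit.QuantumFields.YangMills.Cruxes.DEF1R1WDoorCheck

end
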